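import Literature.Computability.QuantumComplexity.ZOmegaCodesFP
import Literature.Computability.QuantumComplexity.ADHMachine
import HarnessLib

/-!
# The cone simulator, I: one gate of the exact state-vector DP as an `FP` table transformation

Topic `Literature/Computability/QuantumComplexity`; machine layer realising the dynamic programme of
`StateVectorDP.lean` (`contribBit`, `contrib`, `dpStep`: the new amplitude of a label `z` is the
sum over the carried labels `w` and the two choice bits `c` of `ω^{φ}·a_w` for the valid path steps
`(w, c) ↦ (z, φ)`) in the brick algebra, over the amplitude codes of `ZOmegaCodesFP.lean`
(`ZWCode.enc`/`dec`, `zwAddF`, `zwRotF`). The gate is never parsed here: the path step of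
Adleman–DeMarrais–Huang's machine (`ADH.roundF`, `ADHMachine.lean`, whose value on a walk record is
`ADH.tStep`, `ADH.roundF_rec`) is reused as the entry oracle — run on the one-gate record
`⟨ε, ⟨[g], ⟨[c], ⟨w, ⟨1⁰, [1]⟩⟩⟩⟩⟩` it returns the target label, the phase `1^{φ mod 8}` and the
validity bit of the step of gate `g` from `|w⟩` with choice bit `c`.

* `clipAt C y f` — `f` clipped to `C (|y ·| + 1)` symbols, `y` reading a yardstick off the argument
  (total linear growth for free; identity wherever `f` is that short, `clipAt_eq_self`);
* the **inner fold** `contribSumF` on `W₂ = ⟨⟨ŷ, ⟨g, z⟩⟩, table⟩`: accumulate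
  `acc := acc + contrib g w z a` over the items `⟨w, a⟩` of the table (`step₂`, clipped `step₂c`);
  value `contribSumF_tableEnc`: the code of `Σ_{(w,a) ∈ table} contrib g w z a` whenever all partial
  sums have codes of length `≤ |ŷ| + 1`;
* the **table rebuild** `gateUpdF` on `W₁ = ⟨⟨ŷ, g⟩, table⟩`: cons the items `⟨z, contribSumF …⟩`
  (`step₁`); value `gateUpdF_tableEnc`: the table of `StateVectorDP.dpStep g` over the labels of
  the table, in reverse order;
* `tableEnc l` — the code of a table `l : List (QReg N × ZW)` (label bits `List.ofFn`, amplitude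
  code), and membership in `FP` of everything (`contribSumF_mem_FP`, `gateUpdF_mem_FP`, via
  `foldFn_mem_FP` with the `FoldGrowth` bounds that clipping makes total).

## References

* S. Arora, B. Barak, *Computational Complexity: A Modern Approach*, CUP 2009, §1.3 (polynomial
  time is closed under composition and bounded loops).
* L. M. Adleman, J. DeMarrais, M.-D. A. Huang, *Quantum computability*, SIAM J. Comput. 26 (1997),
  §6 (computational paths through a circuit; reused via `ADH.roundF`).
* M. A. Nielsen, I. L. Chuang, *Quantum Computation and Quantum Information*, CUP 2010, §4.5.5
  (simulation by storing all amplitudes).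
-/

noncomputable section

namespace Literature.Computability.QuantumComplexity

namespace ConeSim

open _root_.Computability Polynomial Complexity Complexity.Brick Cryptography ZW ZWCode ADH

attribute [-simp] Brick.nthF_zero Brick.sndPow_zero

/-! ### Clipping at a yardstick -/

/-- **`f` clipped to `C (|y z| + 1)` symbols**, the yardstick being read off the argument by `y`.
[folklore] -/
def clipAt (C : ℕ) (y f : List Bool → List Bool) : List Bool → List Bool :=
  Plumb.takeFn ∘ fanoutFn (Plumb.polyFn (Polynomial.C C * (X + 1)) ∘ y) f

/-- Value of `clipAt`. [folklore] -/
theorem clipAt_apply (C : ℕ) (y f : List Bool → List Bool) (z : List Bool) :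
    clipAt C y f z = (f z).take (C * ((y z).length + 1)) := by
  simp [clipAt, ones]

/-- The clipped function is short, on every input. [folklore] -/
theorem length_clipAt_le (C : ℕ) (y f : List Bool → List Bool) (z : List Bool) :
    (clipAt C y f z).length ≤ C * ((y z).length + 1) := by
  rw [clipAt_apply]; exact List.length_take_le _ _

/-- The clipped function is not longer than the original. [folklore] -/
theorem length_clipAt_le' (C : ℕ) (y f : List Bool → List Bool) (z : List Bool) :
    (clipAt C y f z).length ≤ (f z).length := by
  rw [clipAt_apply]; exact List.length_take_le' _ _

/-- Clipping is the identity where the value is short. [folklore] -/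
theorem clipAt_eq_self {C : ℕ} {y f : List Bool → List Bool} {z : List Bool}
    (h : (f z).length ≤ C * ((y z).length + 1)) : clipAt C y f z = f z := by
  rw [clipAt_apply, List.take_of_length_le h]

/-- `clipAt C y f ∈ FP`. [cite: AroraBarakCC2009, §1.3] -/
theorem clipAt_mem_FP (C : ℕ) {y f : List Bool → List Bool} (hy : y ∈ FP) (hf : f ∈ FP) : clipAt C y f ∈ FP :=
  comp_mem_FP Plumb.takeFn_mem_FP (fanoutFn_mem_FP (comp_mem_FP (Plumb.polyFn_mem_FP _) hy) hf)

/-! ### Tables -/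

variable {N : ℕ}

/-- The code of a table item `⟨label bits, amplitude code⟩`. [folklore] -/
def itemEnc (p : QReg N × ZW) : List Bool := boolPair (List.ofFn p.1) (enc p.2)

/-- **The code of a table**: the coded list of its items. [folklore] -/
def tableEnc (l : List (QReg N × ZW)) : List Bool := encList (l.map itemEnc)

/-- The empty table. [folklore] -/
@[simp] theorem tableEnc_nil : tableEnc ([] : List (QReg N × ZW)) = [] := rfl

/-- A table with a first item. [folklore] -/
theorem tableEnc_cons (p : QReg N × ZW) (l : List (QReg N × ZW)) :
    tableEnc (p :: l) = boolPair (itemEnc p) (tableEnc l) := rfl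

/-- The items of a table. [folklore] -/
@[simp] theorem decNil_tableEnc (l : List (QReg N × ZW)) : decNil (tableEnc l) = l.map itemEnc := by
  rw [tableEnc, decNil_encList]

/-! ### The entry oracle: one path step through `ADH.roundF` -/

/-- Yardstick `ŷ` of the inner step argument `⟨⟨⟨ŷ, ⟨g, z⟩⟩, table⟩, ⟨⟨w, a⟩, acc⟩⟩`. [folklore] -/
def y₂F : List Bool → List Bool := fstF ∘ fstF ∘ fstF
/-- Gate code `g` of the inner step argument. [folklore] -/
def g₂F : List Bool → List Bool := fstF ∘ sndF ∘ fstF ∘ fstF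
/-- Target label `z` of the inner step argument. [folklore] -/
def z₂F : List Bool → List Bool := sndF ∘ sndF ∘ fstF ∘ fstF
/-- Source label `w` (first field of the item). [folklore] -/
def w₂F : List Bool → List Bool := fstF ∘ fstF ∘ sndF
/-- Source amplitude code `a` (second field of the item). [folklore] -/
def a₂F : List Bool → List Bool := sndF ∘ fstF ∘ sndF
/-- The accumulator (partial sum). [folklore] -/
def acc₂F : List Bool → List Bool := sndF ∘ sndF

/-- The one-gate walk record `⟨ε, ⟨[g], ⟨[c], ⟨w, ⟨ε, [1]⟩⟩⟩⟩⟩` handed to `ADH.roundF`. [folklore] -/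
def stepRecC (c : Bool) : List Bool → List Bool :=
  mk6 (fun _ => []) (fanoutFn g₂F (fun _ => [])) (fun _ => [c]) w₂F (fun _ => []) (fun _ => [true])

/-- **The path step with choice bit `c`**, by `ADH.roundF`. [cite: AdlemanDeMarraisHuang1997, §6 Lemma 6.10 (proof, step 3)] -/
def stepOutC (c : Bool) : List Bool → List Bool := roundF ∘ stepRecC c

/-- The step is valid and lands on the target label. [folklore] -/
def condC (c : Bool) : List Bool → List Bool :=
  andFn (eqC [true] (ADH.vF ∘ stepOutC c)) (eqPairFn ∘ fanoutFn (ADH.wF ∘ stepOutC c) z₂F)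

/-- **The contribution of the source item through choice bit `c`**: `ω^φ · a` if the step is valid
and lands on `z`, else `0`. [folklore] -/
def cbC (c : Bool) : List Bool → List Bool :=
  iteFn (condC c) (zwRotF ∘ fanoutFn (ADH.phF ∘ stepOutC c) a₂F) (fun _ => enc 0)

/-- **The inner step**: `acc + (contribution via 0) + (contribution via 1)`. [folklore] -/
def step₂ : List Bool → List Bool := zwAddF ∘ fanoutFn acc₂F (zwAddF ∘ fanoutFn (cbC false) (cbC true))

/-- The inner step, clipped at the yardstick. [folklore] -/
def step₂c : List Bool → List Bool := clipAt 1 y₂F step₂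

/-- **The inner fold**: the sum of the contributions of all items to the target. [folklore] -/
def contribSumF : List Bool → List Bool := foldFn step₂c (fun _ => enc 0)

/-! ### Membership in `FP` -/

/-- `y₂F ∈ FP` (projections). [folklore] -/
theorem y₂F_mem_FP : y₂F ∈ FP := comp_mem_FP fstF_mem_FP (comp_mem_FP fstF_mem_FP fstF_mem_FP)
/-- `g₂F ∈ FP` (projections). [folklore] -/
theorem g₂F_mem_FP : g₂F ∈ FP := comp_mem_FP fstF_mem_FP (comp_mem_FP sndF_mem_FP (comp_mem_FP fstF_mem_FP fstF_mem_FP))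
/-- `z₂F ∈ FP` (projections). [folklore] -/
theorem z₂F_mem_FP : z₂F ∈ FP := comp_mem_FP sndF_mem_FP (comp_mem_FP sndF_mem_FP (comp_mem_FP fstF_mem_FP fstF_mem_FP))
/-- `w₂F ∈ FP` (projections). [folklore] -/
theorem w₂F_mem_FP : w₂F ∈ FP := comp_mem_FP fstF_mem_FP (comp_mem_FP fstF_mem_FP sndF_mem_FP)
/-- `a₂F ∈ FP` (projections). [folklore] -/
theorem a₂F_mem_FP : a₂F ∈ FP := comp_mem_FP sndF_mem_FP (comp_mem_FP fstF_mem_FP sndF_mem_FP)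
/-- `acc₂F ∈ FP` (projections). [folklore] -/
theorem acc₂F_mem_FP : acc₂F ∈ FP := comp_mem_FP sndF_mem_FP sndF_mem_FP

/-- `stepOutC c ∈ FP`. [cite: AroraBarakCC2009, §1.3] -/
theorem stepOutC_mem_FP (c : Bool) : stepOutC c ∈ FP :=
  comp_mem_FP roundF_mem_FP (mk6_mem_FP (const_mem_FP _) (fanoutFn_mem_FP g₂F_mem_FP (const_mem_FP _)) (const_mem_FP _)
    w₂F_mem_FP (const_mem_FP _) (const_mem_FP _))

/-- `condC c ∈ FP`. [folklore] -/
theorem condC_mem_FP (c : Bool) : condC c ∈ FP :=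
  andFn_mem_FP (eqC_mem_FP _ (comp_mem_FP (sndPow_mem_FP 4) (stepOutC_mem_FP c)))
    (comp_mem_FP eqPairFn_mem_FP (fanoutFn_mem_FP (comp_mem_FP (nthF_mem_FP 3) (stepOutC_mem_FP c)) z₂F_mem_FP))

/-- `cbC c ∈ FP`. [folklore] -/
theorem cbC_mem_FP (c : Bool) : cbC c ∈ FP :=
  iteFn_mem_FP (condC_mem_FP c) (comp_mem_FP zwRotF_mem_FP (fanoutFn_mem_FP (comp_mem_FP (nthF_mem_FP 4) (stepOutC_mem_FP c)) a₂F_mem_FP))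
    (const_mem_FP _)

/-- `step₂ ∈ FP`. [folklore] -/
theorem step₂_mem_FP : step₂ ∈ FP :=
  comp_mem_FP zwAddF_mem_FP (fanoutFn_mem_FP acc₂F_mem_FP (comp_mem_FP zwAddF_mem_FP (fanoutFn_mem_FP (cbC_mem_FP false) (cbC_mem_FP true))))

/-- `step₂c ∈ FP`. [folklore] -/
theorem step₂c_mem_FP : step₂c ∈ FP := clipAt_mem_FP 1 y₂F_mem_FP step₂_mem_FP

/-- The yardstick is inside the context: `|y₂F v| ≤ |fstF v|`. [folklore] -/
theorem length_y₂F_le (v : List Bool) : (y₂F v).length ≤ (fstF v).length := by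
  have h1 := length_fstF_sndF_le (fstF v)
  have h2 := length_fstF_sndF_le (fstF (fstF v))
  simp only [y₂F, Function.comp_apply]
  omega

/-- **The clipped inner step has total linear growth** (`FoldGrowth 1`). [folklore] -/
theorem foldGrowth_step₂c : FoldGrowth 1 step₂c := fun v =>
  (length_clipAt_le 1 y₂F step₂ v).trans (by have := length_y₂F_le v; omega)

/-- **`contribSumF ∈ FP`.** [cite: AroraBarakCC2009, §1.3] -/
theorem contribSumF_mem_FP : contribSumF ∈ FP := foldFn_mem_FP step₂c_mem_FP (const_mem_FP _) foldGrowth_step₂c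

/-! ### Values on genuine arguments -/

section Values

variable (Y gc zl tbl : List Bool)

/-- The genuine inner step argument. [folklore] -/
def arg₂ (wl a acc : List Bool) : List Bool :=
  boolPair (boolPair (boolPair Y (boolPair gc zl)) tbl) (boolPair (boolPair wl a) acc)

/-- The projections of a genuine inner step argument. [folklore] -/
theorem proj_arg₂ (wl a acc : List Bool) :
    y₂F (arg₂ Y gc zl tbl wl a acc) = Y ∧ g₂F (arg₂ Y gc zl tbl wl a acc) = gc ∧
      z₂F (arg₂ Y gc zl tbl wl a acc) = zl ∧ w₂F (arg₂ Y gc zl tbl wl a acc) = wl ∧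
      a₂F (arg₂ Y gc zl tbl wl a acc) = a ∧ acc₂F (arg₂ Y gc zl tbl wl a acc) = acc ∧
      fstF (arg₂ Y gc zl tbl wl a acc) = boolPair (boolPair Y (boolPair gc zl)) tbl := by
  simp [arg₂, y₂F, g₂F, z₂F, w₂F, a₂F, acc₂F]

variable {Y gc zl tbl}

/-- **The entry oracle computes `ADH.tStep`**: on a genuine argument carrying the code of the
oracle-free gate `g` and the source label `w`, `stepOutC c` returns the walk record of
`tStep g c (w, 0, valid)`. [cite: AdlemanDeMarraisHuang1997, §6 Lemma 6.10 (proof, step 3)] -/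
theorem stepOutC_arg₂ (c : Bool) (g : QGate cliffordT N) (hg : g.IsOracleFree) (w : QReg N) (a acc : List Bool) :
    stepOutC c (arg₂ Y g.encode zl tbl (List.ofFn w) a acc) =
      rec6 [] [] [] (List.ofFn (tStep g c (w, 0, true)).1) (ones (tStep g c (w, 0, true)).2.1)
        [(tStep g c (w, 0, true)).2.2] := by
  obtain ⟨-, hg₂, -, hw, -, -, -⟩ := proj_arg₂ Y g.encode zl tbl (List.ofFn w) a acc
  have hrec : stepRecC c (arg₂ Y g.encode zl tbl (List.ofFn w) a acc) =
      rec6 [] (encList (g.encode :: [])) [c] (List.ofFn w) (ones 0) [true] := by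
    rw [stepRecC, mk6_apply, fanoutFn_apply, hg₂, hw, encList_cons, encList_nil]
    rfl
  rw [stepOutC, Function.comp_apply, hrec, roundF_rec [] [] [c] w g hg 0 true]
  simp

/-- The contribution through `c` on a genuine argument is the code of `contribBit`. [folklore] -/
theorem cbC_arg₂ (c : Bool) (g : QGate cliffordT N) (hg : g.IsOracleFree) (w z : QReg N) (a acc : List Bool) :
    cbC c (arg₂ Y g.encode (List.ofFn z) tbl (List.ofFn w) a acc) = enc (contribBit g c w z (dec a)) := by
  set v := arg₂ Y g.encode (List.ofFn z) tbl (List.ofFn w) a acc with hv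
  obtain ⟨-, -, hz, -, ha, -, -⟩ := proj_arg₂ Y g.encode (List.ofFn z) tbl (List.ofFn w) a acc
  have hs := stepOutC_arg₂ (Y := Y) (zl := List.ofFn z) (tbl := tbl) c g hg w a acc
  rw [← hv] at hs hz ha
  have hvF : (ADH.vF ∘ stepOutC c) v = [(tStep g c (w, 0, true)).2.2] := by
    rw [Function.comp_apply, hs]; simp [sndPow]
  have hwF : (ADH.wF ∘ stepOutC c) v = List.ofFn (tStep g c (w, 0, true)).1 := by
    rw [Function.comp_apply, hs]; simp [nthF]
  have hphF : (ADH.phF ∘ stepOutC c) v = ones (tStep g c (w, 0, true)).2.1 := by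
    rw [Function.comp_apply, hs]; simp [nthF]
  have hcond : condC c v = [(tStep g c (w, 0, true)).2.2 && decide ((tStep g c (w, 0, true)).1 = z)] := by
    rw [condC, andFn_apply (b := (tStep g c (w, 0, true)).2.2) (b' := decide ((tStep g c (w, 0, true)).1 = z))]
    · rw [eqC_apply, hvF]
      cases (tStep g c (w, 0, true)).2.2 <;> simp
    · rw [Function.comp_apply, fanoutFn_apply, hwF, hz, eqPairFn_boolPair]
      simp [List.ofFn_inj]
  rw [cbC, iteFn_apply hcond, tStep_true]
  unfold contribBit
  rcases hps : pathStep g c w with _ | ⟨w', ψ⟩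
  · simp
  · simp only
    by_cases hwz : w' = z
    · subst hwz
      simp only [decide_true, Bool.and_self, if_true]
      rw [Function.comp_apply, fanoutFn_apply, hphF, ha, tStep_true, hps]
      simp only [zero_add]
      exact zwRotF_boolPair _ (Nat.mod_lt _ (by norm_num)) a
    · simp [hwz]

/-- **The inner step on a genuine argument**: `acc + contrib g w z a`, as codes. [folklore] -/
theorem step₂_arg₂ (g : QGate cliffordT N) (hg : g.IsOracleFree) (w z : QReg N) (a acc : List Bool) :
    step₂ (arg₂ Y g.encode (List.ofFn z) tbl (List.ofFn w) a acc) = enc (dec acc + contrib g w z (dec a)) := by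
  obtain ⟨-, -, -, -, -, hacc, -⟩ := proj_arg₂ Y g.encode (List.ofFn z) tbl (List.ofFn w) a acc
  rw [step₂, Function.comp_apply, fanoutFn_apply, hacc, Function.comp_apply, fanoutFn_apply,
    cbC_arg₂ false g hg w z a acc, cbC_arg₂ true g hg w z a acc, zwAddF_boolPair, zwAddF_boolPair,
    dec_enc, dec_enc, dec_enc, contrib]

/-- The clipped inner step agrees with the step when the sum has a short code. [folklore] -/
theorem step₂c_arg₂ (g : QGate cliffordT N) (hg : g.IsOracleFree) (w z : QReg N) (a acc : List Bool)
    (hlen : (enc (dec acc + contrib g w z (dec a))).length ≤ Y.length + 1) :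
    step₂c (arg₂ Y g.encode (List.ofFn z) tbl (List.ofFn w) a acc) = enc (dec acc + contrib g w z (dec a)) := by
  obtain ⟨hy, -, -, -, -, -, -⟩ := proj_arg₂ Y g.encode (List.ofFn z) tbl (List.ofFn w) a acc
  rw [step₂c, clipAt_eq_self, step₂_arg₂ g hg w z a acc]
  rw [step₂_arg₂ g hg w z a acc, hy]
  simpa using hlen

/-- The partial sums of the contributions of a table to a target. [folklore] -/
def partialSum (g : QGate cliffordT N) (z : QReg N) (s : ZW) (l : List (QReg N × ZW)) : ZW :=
  l.foldl (fun acc p => acc + contrib g p.1 z p.2) s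

/-- `partialSum` from `s` is `s` plus the partial sum from `0`. [folklore] -/
theorem partialSum_eq_add (g : QGate cliffordT N) (z : QReg N) :
    ∀ (l : List (QReg N × ZW)) (s : ZW), partialSum g z s l = s + partialSum g z 0 l := by
  intro l
  induction l with
  | nil => intro s; simp [partialSum]
  | cons p l ih =>
    intro s
    simp only [partialSum, List.foldl_cons, zero_add]
    rw [← partialSum, ← partialSum, ih (s + contrib g p.1 z p.2), ih (contrib g p.1 z p.2), add_assoc]

/-- The full partial sum is the `dpStep` sum over the labels of the table (amplitudes read off the
table). [folklore] -/
theorem partialSum_zero_eq_sum (g : QGate cliffordT N) (z : QReg N) (l : List (QReg N × ZW)) :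
    partialSum g z 0 l = (l.map fun p => contrib g p.1 z p.2).sum := by
  induction l with
  | nil => simp [partialSum]
  | cons p l ih =>
    simp only [partialSum, List.foldl_cons, zero_add, List.map_cons, List.sum_cons]
    rw [← partialSum, partialSum_eq_add, ih]

/-- **Value of the inner fold on a genuine table**: the code of the sum of all contributions,
provided every partial sum has a code of length `≤ |ŷ| + 1` (so that clipping never bites).
[cite: NielsenChuang2010, §4.5.5] -/
theorem contribSumF_tableEnc (g : QGate cliffordT N) (hg : g.IsOracleFree) (z : QReg N) (l : List (QReg N × ZW))
    (hlen : ∀ l₁ l₂, l = l₁ ++ l₂ → (enc (partialSum g z 0 l₁)).length ≤ Y.length + 1) :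
    contribSumF (boolPair (boolPair Y (boolPair g.encode (List.ofFn z))) (tableEnc l)) = enc (partialSum g z 0 l) := by
  rw [contribSumF, foldFn_boolPair, decNil_tableEnc]
  -- generalise over a processed prefix
  suffices h : ∀ (l₂ l₁ : List (QReg N × ZW)), l = l₁ ++ l₂ →
      (l₂.map itemEnc).foldl (fun acc a => step₂c (boolPair (boolPair (boolPair Y (boolPair g.encode (List.ofFn z))) (tableEnc l))
        (boolPair a acc))) (enc (partialSum g z 0 l₁)) = enc (partialSum g z 0 (l₁ ++ l₂)) by
    have := h l [] (by simp)
    simpa [partialSum] using this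
  intro l₂
  induction l₂ with
  | nil => intro l₁ _; simp
  | cons p l₂ ih =>
    intro l₁ hl
    rw [List.map_cons, List.foldl_cons]
    have hstep : step₂c (boolPair (boolPair (boolPair Y (boolPair g.encode (List.ofFn z))) (tableEnc l))
        (boolPair (itemEnc p) (enc (partialSum g z 0 l₁)))) = enc (partialSum g z 0 (l₁ ++ [p])) := by
      have hps : partialSum g z 0 (l₁ ++ [p]) = partialSum g z 0 l₁ + contrib g p.1 z p.2 := by
        simp [partialSum, List.foldl_append]
      have h := step₂c_arg₂ (Y := Y) (tbl := tableEnc l) g hg p.1 z (enc p.2) (enc (partialSum g z 0 l₁))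
        (by rw [dec_enc, dec_enc, ← hps]; exact hlen (l₁ ++ [p]) l₂ (by rw [hl]; simp))
      rw [dec_enc, dec_enc, ← hps] at h
      exact h
    rw [show boolPair (itemEnc p) (enc (partialSum g z 0 l₁)) = boolPair (itemEnc p) (enc (partialSum g z 0 l₁)) from rfl,
      hstep, ih (l₁ ++ [p]) (by rw [hl]; simp)]
    simp

end Values

/-! ### The table rebuild for one gate -/

/-- Yardstick `ŷ` of the outer step argument `⟨⟨⟨ŷ, g⟩, table⟩, ⟨⟨z, a⟩, acc⟩⟩`. [folklore] -/
def y₁F : List Bool → List Bool := fstF ∘ fstF ∘ fstF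
/-- Gate code of the outer step argument. [folklore] -/
def g₁F : List Bool → List Bool := sndF ∘ fstF ∘ fstF
/-- The table being read. [folklore] -/
def tbl₁F : List Bool → List Bool := sndF ∘ fstF
/-- The target label (first field of the item). [folklore] -/
def z₁F : List Bool → List Bool := fstF ∘ fstF ∘ sndF
/-- The accumulator (the new table under construction). [folklore] -/
def acc₁F : List Bool → List Bool := sndF ∘ sndF

/-- The argument `W₂ = ⟨⟨ŷ, ⟨g, z⟩⟩, table⟩` of the inner fold. [folklore] -/
def sumArgF : List Bool → List Bool := fanoutFn (fanoutFn y₁F (fanoutFn g₁F z₁F)) tbl₁F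

/-- **The new amplitude of the target**, clipped at the yardstick. [folklore] -/
def newAmpF : List Bool → List Bool := clipAt 1 y₁F (contribSumF ∘ sumArgF)

/-- **The outer step**: cons the item `⟨z, new amplitude⟩` onto the new table. [folklore] -/
def step₁ : List Bool → List Bool := fanoutFn (fanoutFn z₁F newAmpF) acc₁F

/-- **The table rebuild for one gate** on `W₁ = ⟨⟨ŷ, g⟩, table⟩`. [cite: NielsenChuang2010, §4.5.5] -/
def gateUpdF : List Bool → List Bool := foldFn step₁ (fun _ => [])

/-- `y₁F ∈ FP` (projections). [folklore] -/
theorem y₁F_mem_FP : y₁F ∈ FP := comp_mem_FP fstF_mem_FP (comp_mem_FP fstF_mem_FP fstF_mem_FP)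
/-- `g₁F ∈ FP` (projections). [folklore] -/
theorem g₁F_mem_FP : g₁F ∈ FP := comp_mem_FP sndF_mem_FP (comp_mem_FP fstF_mem_FP fstF_mem_FP)
/-- `tbl₁F ∈ FP` (projections). [folklore] -/
theorem tbl₁F_mem_FP : tbl₁F ∈ FP := comp_mem_FP sndF_mem_FP fstF_mem_FP
/-- `z₁F ∈ FP` (projections). [folklore] -/
theorem z₁F_mem_FP : z₁F ∈ FP := comp_mem_FP fstF_mem_FP (comp_mem_FP fstF_mem_FP sndF_mem_FP)
/-- `acc₁F ∈ FP` (projections). [folklore] -/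
theorem acc₁F_mem_FP : acc₁F ∈ FP := comp_mem_FP sndF_mem_FP sndF_mem_FP
/-- `sumArgF ∈ FP`. [folklore] -/
theorem sumArgF_mem_FP : sumArgF ∈ FP :=
  fanoutFn_mem_FP (fanoutFn_mem_FP y₁F_mem_FP (fanoutFn_mem_FP g₁F_mem_FP z₁F_mem_FP)) tbl₁F_mem_FP
/-- `newAmpF ∈ FP`. [folklore] -/
theorem newAmpF_mem_FP : newAmpF ∈ FP := clipAt_mem_FP 1 y₁F_mem_FP (comp_mem_FP contribSumF_mem_FP sumArgF_mem_FP)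
/-- `step₁ ∈ FP`. [folklore] -/
theorem step₁_mem_FP : step₁ ∈ FP := fanoutFn_mem_FP (fanoutFn_mem_FP z₁F_mem_FP newAmpF_mem_FP) acc₁F_mem_FP

/-- **The outer step has total growth `FoldGrowth 8`** (the new amplitude is clipped at the
yardstick, which sits inside the context). [folklore] -/
theorem foldGrowth_step₁ : FoldGrowth 8 step₁ := fun v => by
  have hy : (y₁F v).length ≤ (fstF v).length := by
    have h1 := length_fstF_sndF_le (fstF v)
    have h2 := length_fstF_sndF_le (fstF (fstF v))
    simp only [y₁F, Function.comp_apply]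
    omega
  have hz : (z₁F v).length ≤ (fstF (sndF v)).length := by
    have := length_fstF_sndF_le (fstF (sndF v))
    simp only [z₁F, Function.comp_apply]
    omega
  have hn := length_clipAt_le 1 y₁F (contribSumF ∘ sumArgF) v
  rw [step₁, length_fanoutFn, length_fanoutFn]
  simp only [acc₁F, newAmpF, Function.comp_apply] at hn ⊢
  nlinarith

/-- **`gateUpdF ∈ FP`.** [cite: AroraBarakCC2009, §1.3] -/
theorem gateUpdF_mem_FP : gateUpdF ∈ FP := foldFn_mem_FP step₁_mem_FP (const_mem_FP _) foldGrowth_step₁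

section Values₁

variable (Y : List Bool)

/-- **Value of the outer step on a genuine argument**: cons of the item `⟨z, Σ contributions⟩`,
provided the partial sums are short. [folklore] -/
theorem step₁_arg (g : QGate cliffordT N) (hg : g.IsOracleFree) (l : List (QReg N × ZW)) (z : QReg N)
    (a acc : List Bool)
    (hlen : ∀ l₁ l₂, l = l₁ ++ l₂ → (enc (partialSum g z 0 l₁)).length ≤ Y.length + 1) :
    step₁ (boolPair (boolPair (boolPair Y g.encode) (tableEnc l)) (boolPair (boolPair (List.ofFn z) a) acc)) =
      boolPair (boolPair (List.ofFn z) (enc (partialSum g z 0 l))) acc := by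
  have harg : sumArgF (boolPair (boolPair (boolPair Y g.encode) (tableEnc l)) (boolPair (boolPair (List.ofFn z) a) acc)) =
      boolPair (boolPair Y (boolPair g.encode (List.ofFn z))) (tableEnc l) := by
    simp [sumArgF, y₁F, g₁F, z₁F, tbl₁F]
  have hin := contribSumF_tableEnc (Y := Y) g hg z l hlen
  have hnew : newAmpF (boolPair (boolPair (boolPair Y g.encode) (tableEnc l)) (boolPair (boolPair (List.ofFn z) a) acc)) =
      enc (partialSum g z 0 l) := by
    rw [newAmpF, clipAt_eq_self]
    · rw [Function.comp_apply, harg, hin]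
    · rw [Function.comp_apply, harg, hin]
      have hy : y₁F (boolPair (boolPair (boolPair Y g.encode) (tableEnc l)) (boolPair (boolPair (List.ofFn z) a) acc)) = Y := by
        simp [y₁F]
      rw [hy]
      simpa using hlen l [] (by simp)
  rw [step₁, fanoutFn_apply, fanoutFn_apply, hnew]
  simp [z₁F, acc₁F]

/-- **Value of the table rebuild on a genuine table**: the new items `⟨z, dpStep-sum⟩` over the
targets `z` of the table, consed in turn (hence in reverse order), provided all partial sums of all
targets are short. [cite: NielsenChuang2010, §4.5.5] -/
theorem gateUpdF_tableEnc (g : QGate cliffordT N) (hg : g.IsOracleFree) (l : List (QReg N × ZW))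
    (hlen : ∀ z ∈ l.map Prod.fst, ∀ l₁ l₂, l = l₁ ++ l₂ → (enc (partialSum g z 0 l₁)).length ≤ Y.length + 1) :
    gateUpdF (boolPair (boolPair Y g.encode) (tableEnc l)) =
      tableEnc (l.map fun p => (p.1, partialSum g p.1 0 l)).reverse := by
  rw [gateUpdF, foldFn_boolPair, decNil_tableEnc]
  suffices h : ∀ (l₂ : List (QReg N × ZW)) (accl : List (QReg N × ZW)), (∀ p ∈ l₂, p ∈ l) →
      (l₂.map itemEnc).foldl (fun acc a => step₁ (boolPair (boolPair (boolPair Y g.encode) (tableEnc l)) (boolPair a acc)))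
        (tableEnc accl) = tableEnc ((l₂.map fun p => (p.1, partialSum g p.1 0 l)).reverse ++ accl) by
    simpa using h l [] (fun p hp => hp)
  intro l₂
  induction l₂ with
  | nil => intro accl _; simp
  | cons p l₂ ih =>
    intro accl hsub
    rw [List.map_cons, List.foldl_cons]
    have hp : p ∈ l := hsub p (by simp)
    have hstep := step₁_arg Y g hg l p.1 (enc p.2) (tableEnc accl)
      (hlen p.1 (List.mem_map.2 ⟨p, hp, rfl⟩))
    rw [show itemEnc p = boolPair (List.ofFn p.1) (enc p.2) from rfl, hstep,
      show boolPair (boolPair (List.ofFn p.1) (enc (partialSum g p.1 0 l))) (tableEnc accl) =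
        tableEnc ((p.1, partialSum g p.1 0 l) :: accl) from rfl,
      ih _ (fun p' hp' => hsub p' (by simp [hp']))]
    simp

end Values₁

end ConeSim

end Literature.Computability.QuantumComplexity

end
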